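import Summits.RiemannHypothesis.RiemannHypothesis.Theorems.GroundBartaEvenWinsBeyondArchDeflationM102Common
import HarnessLib

/-!
# RiemannHypothesis / GroundBarta — parity ladder beyond `1` (`EvenWinsBeyondArch`, stmt-RiemannHypothesis-18085):
# shared facts of the A-layer at the window `b = 207/200` (window 207/200 = 1.035 (prover B g21's odd λ-run O1035, μ = 2^-97): right end of the cell that run closes, left end of the next)

Helper file (`--supports stmt-RiemannHypothesis-18085`), RH-free, no named facts, no definitions.  Prover A (gen 24 of unit `sr-gb-rung-a`),
after the per-cell `…Common` template (`…M100Common`, `…M102Common`).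

The window `b = 207/200` is the right end of parity cell 15 or 16 (L-side: prover B g21's format-C odd λ-run `WeilFormatCDataO1035OddRung`, `2⁻⁹⁷ ≤ ε_od(207/200)`) and the left end of cell 15; it lies in the five-prime-power regime `(log 7)/2 < 207/200 ≤ (log 8)/2`
(`m1035_log7half_lt`, `m1035_le_log8half`: `log 8 = 3 log 2 ≥ 2.0794 > 2.06`), prime powers `2, 3, 4, 5, 7` visible.  Only the window-dependent
order facts live here; the sharp prime check of the finals at this window is the window-INDEPENDENT `m102_prime7CheckSharp` of `…M102Common`
(imported; restating it would be a duplicate), the pole check lives in each final, the killing-constant bracket in `…DeflationFivePrimeWindow`.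
-/

set_option linter.dupNamespace false

noncomputable section

namespace Summit.RiemannHypothesis.RiemannHypothesis.Theorems.EvenWinsBeyondArch

open Literature.NumberTheory.LFunctions Finset

/-- `(log 7)/2 < 207/200` ((log 7)/2 = 0.97295507…). [folklore] -/
theorem m1035_log7half_lt : Real.log 7 / 2 < (((207 / 200 : ℚ)) : ℝ) := by
  have h := dt_e7_log7half_bracket.2
  push_cast
  linarith

/-- `207/200 ≤ (log 8)/2` (`log 8 = 3 log 2 = 2.0794… ≥ 2.07`). [folklore] -/
theorem m1035_le_log8half : (((207 / 200 : ℚ)) : ℝ) ≤ Real.log 8 / 2 := by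
  have h := Real.log_two_gt_d9
  have h8 : Real.log 8 = 3 * Real.log 2 := by
    rw [show (8 : ℝ) = 2 ^ 3 by norm_num, Real.log_pow]; push_cast; ring
  push_cast
  rw [h8]
  linarith

/-- `51/50 ≤ 207/200` as real casts of the rational windows (antitone transport of the cell-14 U-side). [folklore] -/
theorem m1035_ge_102 : (((51 / 50 : ℚ)) : ℝ) ≤ (((207 / 200 : ℚ)) : ℝ) := by
  push_cast; norm_num

/-- `0 < 207/200` for the rational window cast. [folklore] -/
theorem m1035_pos : (0 : ℝ) < (((207 / 200 : ℚ)) : ℝ) := by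
  push_cast; norm_num

end Summit.RiemannHypothesis.RiemannHypothesis.Theorems.EvenWinsBeyondArch

end
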